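import Mathlib.Analysis.SpecialFunctions.Pow.Real
import Summits.KontsevichZagierPeriods.KontsevichZagierPeriods.Theorems.SoloInformedEtaleCurve
import Literature.FieldTheory.AlgClosed.PuiseuxFormalBranches
import Literature.FieldTheory.AlgClosed.PuiseuxEtaleShift
import Literature.NumberTheory.Transcendental.KZDilationMove
import Literature.NumberTheory.Transcendental.EllIterRep

/-!
# Preliminaries for the cusp pieces of a semialgebraic arc (Rung 2, file E4a)

Solo programme `solo-KontsevichZagierPeriods-informed`, step L4 of `paper/rung2-v2.md` (one-sided
Puiseux pieces). Four independent tools: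

1. a complex polynomial of degree `< N` which is `O(s^N)` along the real ray `s → 0⁺` vanishes;
2. splitting a truncation of a power series, `trunc (N + m) v = trunc N v + X^N · tail`;
3. the transported relation `p(c + ϵ x′, y) ∈ K[x′][y]` of `p ∈ ℚ[x][y]` at an algebraic point `c`
   (`ϵ = ±1`), its complex evaluation, and its separability over `K((x′))` from a Bezout identity
   `A p + B ∂_y p = c₁(x)`, `c₁ ≠ 0`;
4. the Kontsevich–Zagier change of variables `t ↦ c + ϵ κ t^m` on `(0, 1)` (`κ`, `c` real
   algebraic, `κ > 0`), as an element of `KZ.changeOfVariablesRel`, and its image.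

[Kontsevich–Zagier 2001, §1.2; Bochnak–Coste–Roy 1998, §8.1; folklore]
-/

noncomputable section

open Set Filter Topology
open scoped Polynomial PowerSeries
open Literature.NumberTheory.Transcendental Literature.NumberTheory.Transcendental.KZ
open Literature.ModelTheory.ExponentialFields Literature.FieldTheory.AlgClosed

namespace Summit.KontsevichZagierPeriods.KontsevichZagierPeriods.Theorems

/-! ## 1. Polynomials which are `O(s^N)` at `0⁺` -/

/-- A complex polynomial of degree `< N` with `‖q(s)‖ ≤ C s^N` for real `s ∈ (0, δ)` is zero. -/
theorem soloInformed_poly_eq_zero_of_bound {q : ℂ[X]} {N : ℕ} (hq : q.degree < N) {C δ : ℝ}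
    (hδ : 0 < δ) (h : ∀ s ∈ Ioo (0 : ℝ) δ, ‖q.eval (s : ℂ)‖ ≤ C * s ^ N) : q = 0 := by
  by_contra hq0
  obtain ⟨q₁, hq₁, hdvd⟩ := Polynomial.exists_eq_pow_rootMultiplicity_mul_and_not_dvd q hq0 0
  set m : ℕ := q.rootMultiplicity 0 with hm
  rw [map_zero, sub_zero] at hq₁ hdvd
  have hq₁0 : q₁ ≠ 0 := by
    rintro rfl
    exact hdvd (dvd_zero _)
  have hmN : m < N := by
    have h1 : q.natDegree = m + q₁.natDegree := by
      conv_lhs => rw [hq₁]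
      rw [Polynomial.natDegree_mul (pow_ne_zero _ Polynomial.X_ne_zero) hq₁0,
        Polynomial.natDegree_X_pow]
    have h2 : q.natDegree < N := by
      have := hq
      rw [Polynomial.degree_eq_natDegree hq0] at this
      exact_mod_cast this
    omega
  have heval0 : q₁.eval 0 ≠ 0 := by
    intro h0
    apply hdvd
    have : Polynomial.X - Polynomial.C (0 : ℂ) ∣ q₁ := Polynomial.dvd_iff_isRoot.2 h0
    simpa using this
  -- `‖q₁(s)‖ ≤ C s^(N - m)` on `(0, δ)`
  have hb : ∀ s ∈ Ioo (0 : ℝ) δ, ‖q₁.eval (s : ℂ)‖ ≤ C * s ^ (N - m) := by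
    intro s hs
    have hsm : (0 : ℝ) < s ^ m := pow_pos hs.1 m
    have h1 := h s hs
    rw [hq₁, Polynomial.eval_mul, Polynomial.eval_pow, Polynomial.eval_X, norm_mul, norm_pow,
      Complex.norm_real, Real.norm_eq_abs, abs_of_pos hs.1] at h1
    have h2 : ‖q₁.eval (s : ℂ)‖ * s ^ m ≤ C * s ^ N := by rw [mul_comm]; exact h1
    have h3 : C * s ^ N = C * s ^ (N - m) * s ^ m := by
      rw [mul_assoc, ← pow_add, Nat.sub_add_cancel hmN.le]
    rw [h3] at h2
    exact le_of_mul_le_mul_right h2 hsm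
  -- limit along `s → 0⁺`
  have ht1 : Tendsto (fun s : ℝ => q₁.eval (s : ℂ)) (𝓝[>] 0) (𝓝 (q₁.eval 0)) := by
    have hc : Continuous fun s : ℝ => q₁.eval (s : ℂ) :=
      (Polynomial.continuous q₁).comp Complex.continuous_ofReal
    have := (hc.tendsto 0).mono_left (nhdsWithin_le_nhds (s := Ioi (0 : ℝ)))
    simpa using this
  have ht2 : Tendsto (fun s : ℝ => q₁.eval (s : ℂ)) (𝓝[>] 0) (𝓝 0) := by
    refine squeeze_zero_norm' ?_ ?_ (a := fun s => C * s ^ (N - m))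
    · filter_upwards [Ioo_mem_nhdsGT hδ] with s hs using hb s hs
    · have hc : Tendsto (fun s : ℝ => s ^ (N - m)) (𝓝[>] 0) (𝓝 0) := by
        have := ((continuous_pow (N - m)).tendsto (0 : ℝ)).mono_left
          (nhdsWithin_le_nhds (s := Ioi (0 : ℝ)))
        rwa [zero_pow (Nat.sub_ne_zero_of_lt hmN)] at this
      simpa using hc.const_mul C
  exact heval0 (tendsto_nhds_unique ht1 ht2)

/-! ## 2. Splitting a truncation -/

section Trunc

variable {K : Type*} [Field K]

/-- The tail polynomial `Σ_{i<m} v_{N+i} Xⁱ` of a power series. -/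
def soloInformedTail (v : K⟦X⟧) (N m : ℕ) : K[X] :=
  ∑ i ∈ Finset.range m, Polynomial.monomial i (PowerSeries.coeff (N + i) v)

/-- Coefficients of the tail polynomial. -/
theorem soloInformed_coeff_tail (v : K⟦X⟧) (N m j : ℕ) :
    (soloInformedTail v N m).coeff j = if j < m then PowerSeries.coeff (N + j) v else 0 := by
  simp only [soloInformedTail, Polynomial.finsetSum_coeff, Polynomial.coeff_monomial,
    Finset.sum_ite_eq', Finset.mem_range]

/-- **Splitting a truncation**: `trunc (N + m) v = trunc N v + X^N · tail`. -/
theorem soloInformed_trunc_add (v : K⟦X⟧) (N m : ℕ) :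
    PowerSeries.trunc (N + m) v =
      PowerSeries.trunc N v + Polynomial.X ^ N * soloInformedTail v N m := by
  ext j
  rw [Polynomial.coeff_add, PowerSeries.coeff_trunc, PowerSeries.coeff_trunc,
    Polynomial.coeff_X_pow_mul', soloInformed_coeff_tail]
  by_cases h1 : j < N
  · simp [h1, show j < N + m by omega, show ¬ N ≤ j by omega]
  · by_cases h2 : j < N + m
    · simp [h1, h2, show N ≤ j by omega, show j - N < m by omega, show N + (j - N) = j by omega]
    · simp [h1, h2, show N ≤ j by omega, show ¬ (j - N < m) by omega]

/-- If `trunc N v = 0`, the truncation of order `N + m` is `X^N · tail`. -/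
theorem soloInformed_trunc_eq_X_pow_mul (v : K⟦X⟧) {N m : ℕ} (h : PowerSeries.trunc N v = 0) :
    PowerSeries.trunc (N + m) v = Polynomial.X ^ N * soloInformedTail v N m := by
  rw [soloInformed_trunc_add, h, zero_add]

end Trunc

/-! ## 3. The transported relation `p(c + ϵ x′, y)` -/

section Shift

variable {K : Type*} [Field K] [CharZero K]

/-- The substitution `x ↦ c + ϵ x′`: `ℚ[x] → K[x′]`. -/
def soloInformedShift (c : K) (ϵ : ℚ) : ℚ[X] →+* K[X] :=
  Polynomial.eval₂RingHom (Polynomial.C.comp (Rat.castHom K))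
    (Polynomial.C c + Polynomial.C (ϵ : K) * Polynomial.X)

/-- The substitution is composition with the linear polynomial `c + ϵ X`. -/
theorem soloInformedShift_apply (c : K) (ϵ : ℚ) (q : ℚ[X]) :
    soloInformedShift c ϵ q =
      (q.map (Rat.castHom K)).comp (Polynomial.C c + Polynomial.C (ϵ : K) * Polynomial.X) := by
  rw [Polynomial.comp, Polynomial.eval₂_map]
  rfl

/-- The substitution kills no non-zero polynomial (`ϵ ≠ 0`). -/
theorem soloInformedShift_ne_zero (c : K) {ϵ : ℚ} (hϵ : ϵ ≠ 0) {q : ℚ[X]} (hq : q ≠ 0) :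
    soloInformedShift c ϵ q ≠ 0 := by
  rw [soloInformedShift_apply, Ne, Polynomial.comp_eq_zero_iff, not_or]
  refine ⟨(Polynomial.map_ne_zero_iff (Rat.castHom K).injective).2 hq, fun h => ?_⟩
  have h1 := congr_arg (fun r : K[X] => r.coeff 1) h.2
  simp only [Polynomial.coeff_add, Polynomial.coeff_C_mul, Polynomial.coeff_X_one,
    Polynomial.coeff_C_succ, zero_add, mul_one] at h1
  exact hϵ (by exact_mod_cast h1)

/-- The substitution is injective (`ϵ ≠ 0`). -/
theorem soloInformedShift_injective (c : K) {ϵ : ℚ} (hϵ : ϵ ≠ 0) :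
    Function.Injective (soloInformedShift c ϵ) :=
  (injective_iff_map_eq_zero _).2 fun q h => by
    by_contra hq
    exact soloInformedShift_ne_zero c hϵ hq h

/-- The transported bivariate polynomial `P(x′, y) = p(c + ϵ x′, y) ∈ K[x′][y]`. -/
def soloInformedPc (p : ℚ[X][X]) (c : K) (ϵ : ℚ) : K[X][X] := p.map (soloInformedShift c ϵ)

/-- `P` has the `y`-degree of `p`. -/
theorem soloInformed_natDegree_Pc (p : ℚ[X][X]) (c : K) {ϵ : ℚ} (hϵ : ϵ ≠ 0) :
    (soloInformedPc p c ϵ).natDegree = p.natDegree :=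
  Polynomial.natDegree_map_eq_of_injective (soloInformedShift_injective c hϵ) p

/-- `P ≠ 0` if `p ≠ 0`. -/
theorem soloInformed_Pc_ne_zero {p : ℚ[X][X]} (hp : p ≠ 0) (c : K) {ϵ : ℚ} (hϵ : ϵ ≠ 0) :
    soloInformedPc p c ϵ ≠ 0 :=
  (Polynomial.map_ne_zero_iff (soloInformedShift_injective c hϵ)).2 hp

/-- **Complex evaluation of the transported relation**: `P(x′, W) = p(c + ϵ x′, W)`. -/
theorem soloInformed_evC_Pc [Algebra K ℂ] (p : ℚ[X][X]) (c : K) (ϵ : ℚ) (x W : ℂ) :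
    soloInformedEvC (soloInformedPc p c ϵ) x W =
      soloInformedEvC p (algebraMap K ℂ c + (ϵ : ℂ) * x) W := by
  unfold soloInformedEvC soloInformedPc
  rw [Polynomial.map_map]
  congr 2
  refine Polynomial.ringHom_ext (fun a => ?_) ?_
  · simp [soloInformedShift, Polynomial.coe_eval₂RingHom, map_ratCast, eq_ratCast]
  · simp [soloInformedShift, Polynomial.coe_eval₂RingHom, map_ratCast]

/-- **Separability of the transported relation over `K((x′))`** from a Bezout identity
`A p + B ∂_y p = c₁`, `c₁ ∈ ℚ[x] ∖ {0}`. -/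
theorem soloInformed_separable_Pc {p A B : ℚ[X][X]} {c₁ : ℚ[X]} (hc₁ : c₁ ≠ 0)
    (hbez : A * p + B * Polynomial.derivative p = Polynomial.C c₁) (c : K) {ϵ : ℚ} (hϵ : ϵ ≠ 0) :
    ((soloInformedPc p c ϵ).map ((HahnSeries.ofPowerSeries ℤ K).comp
      (Polynomial.coeToPowerSeries.ringHom : K[X] →+* K⟦X⟧))).Separable := by
  set ι : K[X] →+* LaurentSeries K := (HahnSeries.ofPowerSeries ℤ K).comp
    (Polynomial.coeToPowerSeries.ringHom : K[X] →+* K⟦X⟧) with hι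
  set f : ℚ[X] →+* LaurentSeries K := ι.comp (soloInformedShift c ϵ) with hf
  have hιinj : Function.Injective ι :=
    HahnSeries.ofPowerSeries_injective.comp (Polynomial.coe_injective K)
  have hu : f c₁ ≠ 0 := by
    rw [hf, RingHom.comp_apply]
    exact fun h => soloInformedShift_ne_zero c hϵ hc₁ (hιinj (by rw [h, map_zero]))
  have hP : (soloInformedPc p c ϵ).map ι = p.map f := by
    rw [soloInformedPc, Polynomial.map_map]
  rw [hP, Polynomial.Separable, Polynomial.derivative_map]
  have h := congr_arg (Polynomial.map f) hbez
  rw [Polynomial.map_add, Polynomial.map_mul, Polynomial.map_mul, Polynomial.map_C] at h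
  refine ⟨Polynomial.C (f c₁)⁻¹ * A.map f, Polynomial.C (f c₁)⁻¹ * B.map f, ?_⟩
  rw [mul_assoc, mul_assoc, ← mul_add, h, ← Polynomial.C_mul, inv_mul_cancel₀ hu, Polynomial.C_1]

end Shift

/-! ## 4. The change of variables `t ↦ c + ϵ κ t^m` on `(0, 1)` -/

/-- The open interval `(a, b) ⊂ ℝ¹` (first-coordinate spelling; equal to `soloInformedIoo1 a b`
of file B by `rfl`). -/
def soloInformedSeg (a b : ℝ) : Set (Fin 1 → ℝ) := {t | t 0 ∈ Ioo a b}

/-- The one-sided open segment at `c` with far end `d`: `(c, d)` if `ϵ = 1`, `(d, c)` otherwise. -/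
def soloInformedSide (c d : ℝ) (ϵ : ℚ) : Set (Fin 1 → ℝ) :=
  if ϵ = 1 then soloInformedSeg c d else soloInformedSeg d c

/-- Membership in a one-sided segment, `ϵ = 1`. -/
theorem soloInformed_mem_side_one {c d : ℝ} {t : Fin 1 → ℝ} :
    t ∈ soloInformedSide c d 1 ↔ t 0 ∈ Ioo c d := by
  simp [soloInformedSide, soloInformedSeg]

/-- Membership in a one-sided segment, `ϵ = -1`. -/
theorem soloInformed_mem_side_neg_one {c d : ℝ} {t : Fin 1 → ℝ} :
    t ∈ soloInformedSide c d (-1) ↔ t 0 ∈ Ioo d c := by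
  simp [soloInformedSide, soloInformedSeg, show (-1 : ℚ) ≠ 1 by norm_num]

/-- One-sided segments with algebraic ends are `ℚ`-semialgebraic. -/
theorem isSemialgebraic_soloInformedSide {c d : ℝ} (hc : IsAlgebraic ℚ c) (hd : IsAlgebraic ℚ d)
    (ϵ : ℚ) : IsSemialgebraic ℚ (soloInformedSide c d ϵ) := by
  have key : ∀ {a b : ℝ}, IsAlgebraic ℚ a → IsAlgebraic ℚ b →
      IsSemialgebraic ℚ (soloInformedSeg a b) := by
    intro a b ha hb
    have : soloInformedSeg a b =
        {x : Fin 1 → ℝ | a < x 0} ∩ {x : Fin 1 → ℝ | x 0 < b} := by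
      ext x; simp [soloInformedSeg]
    rw [this]
    exact (isSemialgebraic_setOf_const_lt_apply ha 0).inter
      (isSemialgebraic_setOf_apply_lt_const hb 0)
  unfold soloInformedSide
  split_ifs
  · exact key hc hd
  · exact key hd hc

/-- The power map `t ↦ c + ϵ κ t^m` of `ℝ¹`. -/
def soloInformedPowMap (c κ : ℝ) (ϵ : ℚ) (m : ℕ) (x : Fin 1 → ℝ) : Fin 1 → ℝ :=
  fun _ => c + ϵ * κ * (x 0) ^ m

/-- The coordinates of the power map. -/
@[simp] theorem soloInformedPowMap_apply (c κ : ℝ) (ϵ : ℚ) (m : ℕ) (x : Fin 1 → ℝ) (i : Fin 1) :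
    soloInformedPowMap c κ ϵ m x i = c + ϵ * κ * (x 0) ^ m := rfl

/-- **Image of `(0, 1)` under the power map**: the one-sided segment at `c` with far end
`c + ϵ κ`. -/
theorem soloInformed_powMap_image {c κ : ℝ} (hκ : 0 < κ) {ϵ : ℚ} (hϵ : ϵ = 1 ∨ ϵ = -1) {m : ℕ}
    (hm : 0 < m) :
    soloInformedPowMap c κ ϵ m '' {t : Fin 1 → ℝ | t 0 ∈ Ioo (0 : ℝ) 1} =
      soloInformedSide c (c + ϵ * κ) ϵ := by
  have hm0 : (m : ℝ) ≠ 0 := by exact_mod_cast hm.ne'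
  -- the preimage point of a parameter `w ∈ (0, 1)`
  have hroot : ∀ w ∈ Ioo (0 : ℝ) 1, ∃ t ∈ Ioo (0 : ℝ) 1, t ^ m = w := by
    intro w hw
    refine ⟨w ^ ((m : ℝ)⁻¹), ⟨Real.rpow_pos_of_pos hw.1 _,
      Real.rpow_lt_one hw.1.le hw.2 (by positivity)⟩, ?_⟩
    rw [← Real.rpow_natCast, ← Real.rpow_mul hw.1.le, inv_mul_cancel₀ hm0, Real.rpow_one]
  ext y
  rw [mem_image]
  rcases hϵ with rfl | rfl
  · rw [soloInformed_mem_side_one]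
    constructor
    · rintro ⟨x, hx, rfl⟩
      simp only [mem_setOf_eq, mem_Ioo] at hx
      simp only [soloInformedPowMap_apply, Rat.cast_one, one_mul, mem_Ioo]
      have hp : 0 < (x 0) ^ m := pow_pos hx.1 m
      have hp1 : (x 0) ^ m < 1 := pow_lt_one₀ hx.1.le hx.2 hm.ne'
      constructor <;> nlinarith
    · rintro ⟨h1, h2⟩
      simp only [Rat.cast_one, one_mul] at h1 h2
      obtain ⟨t, ht, htm⟩ := hroot ((y 0 - c) / κ)
        ⟨div_pos (by linarith) hκ, (div_lt_one hκ).2 (by linarith)⟩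
      refine ⟨fun _ => t, ht, funext fun i => ?_⟩
      rw [soloInformedPowMap_apply, Subsingleton.elim i 0]
      simp only [Rat.cast_one, one_mul]
      rw [htm]
      field_simp
      ring
  · rw [soloInformed_mem_side_neg_one]
    constructor
    · rintro ⟨x, hx, rfl⟩
      simp only [mem_setOf_eq, mem_Ioo] at hx
      simp only [soloInformedPowMap_apply, Rat.cast_neg, Rat.cast_one, neg_mul, one_mul, mem_Ioo]
      have hp : 0 < (x 0) ^ m := pow_pos hx.1 m
      have hp1 : (x 0) ^ m < 1 := pow_lt_one₀ hx.1.le hx.2 hm.ne'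
      constructor <;> nlinarith
    · rintro ⟨h1, h2⟩
      simp only [Rat.cast_neg, Rat.cast_one, neg_mul, one_mul] at h1 h2
      obtain ⟨t, ht, htm⟩ := hroot ((c - y 0) / κ)
        ⟨div_pos (by linarith) hκ, (div_lt_one hκ).2 (by linarith)⟩
      refine ⟨fun _ => t, ht, funext fun i => ?_⟩
      rw [soloInformedPowMap_apply, Subsingleton.elim i 0]
      simp only [Rat.cast_neg, Rat.cast_one, neg_mul, one_mul]
      rw [htm]
      field_simp
      ring

/-- The coordinate function of the power map is `ℚ`-semialgebraic (algebraic `c`, `κ`). -/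
theorem soloInformed_isSemialgebraicMapOn_powMap {σ : Set (Fin 1 → ℝ)} (hσ : IsSemialgebraic ℚ σ)
    {c κ : ℝ} (hc : IsAlgebraic ℚ c) (hκ : IsAlgebraic ℚ κ) (ϵ : ℚ) (m : ℕ) :
    IsSemialgebraicMapOn ℚ σ (soloInformedPowMap c κ ϵ m) := by
  refine IsSemialgebraicMapOn.of_forall hσ fun j => ?_
  have h1 := isSemialgebraicFunOn_const_of_isAlgebraic hσ hc
  have h2 : IsSemialgebraicFunOn ℚ σ (fun _ : Fin 1 → ℝ => (ϵ : ℝ) * κ) :=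
    isSemialgebraicFunOn_const_of_isAlgebraic hσ ((isAlgebraic_algebraMap (ϵ : ℚ)).mul hκ)
  have h3 : IsSemialgebraicFunOn ℚ σ (fun x : Fin 1 → ℝ => (x 0) ^ m) := by
    simpa only [map_pow, MvPolynomial.aeval_X] using
      isSemialgebraicFunOn_aeval hσ ((MvPolynomial.X 0) ^ m : MvPolynomial (Fin 1) ℚ)
  exact ((h1.add_holds (h2.mul_holds h3))).congr fun x _ => by
    simp only [Pi.add_apply, Pi.mul_apply, soloInformedPowMap]

/-- The derivative of the power map. -/
theorem soloInformed_hasFDerivAt_powMap (c κ : ℝ) (ϵ : ℚ) (m : ℕ) (x : Fin 1 → ℝ) :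
    HasFDerivAt (soloInformedPowMap c κ ϵ m)
      (((ϵ : ℝ) * κ * (m * (x 0) ^ (m - 1))) • ContinuousLinearMap.id ℝ (Fin 1 → ℝ)) x := by
  have hψ : HasDerivAt (fun u : ℝ => c + ϵ * κ * u ^ m) ((ϵ : ℝ) * κ * (m * (x 0) ^ (m - 1)))
      (x 0) := by
    simpa using ((hasDerivAt_pow m (x 0)).const_mul ((ϵ : ℝ) * κ)).const_add c
  have hproj : HasFDerivAt (fun x : Fin 1 → ℝ => x 0)
      (ContinuousLinearMap.proj (R := ℝ) (φ := fun _ : Fin 1 => ℝ) 0) x :=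
    (ContinuousLinearMap.proj (R := ℝ) (φ := fun _ : Fin 1 => ℝ) 0).hasFDerivAt
  rw [hasFDerivAt_pi']
  intro i
  obtain rfl : i = 0 := Subsingleton.elim _ _
  have hfun : (fun x : Fin 1 → ℝ => soloInformedPowMap c κ ϵ m x 0) =
      (fun u : ℝ => c + ϵ * κ * u ^ m) ∘ fun x : Fin 1 → ℝ => x 0 := rfl
  have hclm : (ContinuousLinearMap.proj (R := ℝ) (φ := fun _ : Fin 1 => ℝ) 0).comp
      ((((ϵ : ℝ) * κ * (m * (x 0) ^ (m - 1)))) • ContinuousLinearMap.id ℝ (Fin 1 → ℝ)) =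
      (((ϵ : ℝ) * κ * (m * (x 0) ^ (m - 1)))) •
        ContinuousLinearMap.proj (R := ℝ) (φ := fun _ : Fin 1 => ℝ) 0 := by
    refine ContinuousLinearMap.ext fun v => ?_
    simp
  rw [hfun, hclm]
  exact hψ.comp_hasFDerivAt x hproj

/-- **The power-map move.** For real algebraic `c`, `κ > 0`, `ϵ = ±1`, `m ≥ 1` and representations
`r = [(0,1), f]`, `r'` with `r'.domain` the image of `(0, 1)` under `Φ(t) = c + ϵ κ t^m` and
`f(t) = r'.integrand (Φ t) · m κ t^{m-1}`, the difference `[r] − [r']` is a change of variables.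
[Kontsevich–Zagier 2001, §1.2 rule (2)] -/
theorem soloInformed_powMove {c κ : ℝ} (hc : IsAlgebraic ℚ c) (hκa : IsAlgebraic ℚ κ) (hκ : 0 < κ)
    {ϵ : ℚ} (hϵ : ϵ = 1 ∨ ϵ = -1) {m : ℕ} (hm : 0 < m) (r r' : IntegralRep 1)
    (hr : r.domain = {t : Fin 1 → ℝ | t 0 ∈ Ioo (0 : ℝ) 1})
    (hr' : r'.domain = soloInformedPowMap c κ ϵ m '' r.domain)
    (hint : ∀ x ∈ r.domain, r.integrand x =
      r'.integrand (soloInformedPowMap c κ ϵ m x) * (m * κ * (x 0) ^ (m - 1))) :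
    of r - of r' ∈ changeOfVariablesRel := by
  have hϵκ : (ϵ : ℝ) * κ ≠ 0 := by
    refine mul_ne_zero ?_ hκ.ne'
    rcases hϵ with rfl | rfl <;> norm_num
  refine ⟨1, r, r', soloInformedPowMap c κ ϵ m,
    fun x => (((ϵ : ℝ) * κ * (m * (x 0) ^ (m - 1))) • ContinuousLinearMap.id ℝ (Fin 1 → ℝ)),
    soloInformed_isSemialgebraicMapOn_powMap r.isSemialgebraic_domain hc hκa ϵ m,
    fun x _ => (soloInformed_hasFDerivAt_powMap c κ ϵ m x).hasFDerivWithinAt,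
    fun x hx y hy hxy => ?_, hr', fun x hx => ?_, rfl⟩
  · rw [hr] at hx hy
    have h0 := congr_fun hxy 0
    simp only [soloInformedPowMap_apply, add_right_inj] at h0
    have hpow : (x 0) ^ m = (y 0) ^ m := mul_left_cancel₀ hϵκ h0
    have hxy0 : x 0 = y 0 := (pow_left_inj₀ hx.1.le hy.1.le hm.ne').1 hpow
    funext i
    rw [Subsingleton.elim i 0, hxy0]
  · rw [hint x hx, det_smul_id_fin, pow_one]
    rw [hr] at hx
    have hpos : 0 ≤ κ * (m * (x 0) ^ (m - 1)) := by
      have := hx.1.le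
      positivity
    rcases hϵ with rfl | rfl
    · rw [Rat.cast_one, one_mul, abs_of_nonneg hpos]
      ring
    · simp only [Rat.cast_neg, Rat.cast_one, neg_mul, one_mul, abs_neg, abs_of_nonneg hpos]
      ring

end Summit.KontsevichZagierPeriods.KontsevichZagierPeriods.Theorems
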